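import Summits.BirchSwinnertonDyer.BirchSwinnertonDyer.Theorems.Rank1ResidualX1Converse
import Literature.NumberTheory.EllipticCurves.Rank1Residual.EisensteinGoodComplement
import Literature.NumberTheory.EllipticCurves.Rank1Residual.ClassX1KellerYinCertificate
import Literature.NumberTheory.EllipticCurves.Rank1Residual.ClassX1Isogeny
import HarnessLib

/-!
# Good Eisenstein primes `p > 2` in analytic rank `≤ 1`: the WHOLE locus in one kernel sentence —
# `BSD(E,p)` there ⟺ the class statement X1 ⟺ (granted Keller–Yin) Mazur's main conjecture at the
# rank-`0` class-X1 pairs; no per-pair datum anywhere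

HONEST FRAMING (cell `b2b-bsdres`, home `run/shared/lean/b2b/bsd-rank1-residual/`, unit
`b2b-bsdres-x1a`, gen 6). The goal is to DELETE the COMBINATION-SHAPED residual classes for ALL
analytic-rank `≤ 1` curves over `ℚ` — "full BSD formula for every rank `≤ 1` curve in class C"
assembled STRICTLY from published theorems — so that the rank-`≤ 1` remainder becomes exactly the
CONSTRUCTION-SHAPED classes, which are TYPED (missing-input `Prop`s), NOT attempted; this is not
"finishing BSD". Announced preprints (Keller–Yin arXiv:2402.12781v2) enter ONLY as the explicitly
labelled OPEN hypothesis `KellerYin2024.thm421_rankOne_display_OPEN`, never as theorems.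

What this file adds (theorems only; no definition, no named fact). Until gen 6 the cell's boundary
theorem "outside X1, good Eisenstein `p > 2` in `r_an ≤ 1` is covered by PUBLISHED theorems"
(`Rank1Residual.bsdp_of_good_red_of_not_classX1`, harvest seat) carried ONE per-pair datum, the
torsion bit `p ∤ #E(ℚ)_tors` at non-anomalous `p` (automatic in print, absent from the tree). Gen 6
proved it (`Literature/NumberTheory/EllipticCurves/AnomalousOfRationalTorsionProofs.lean`: a rational
point of order `p` at a good `p ≥ 3` forces `a_p ≡ 1 (mod p)`, Silverman AEC VII.3.1/VII.3.4), so the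
boundary is now binder-free (`Rank1Residual.bsdp_of_not_classX1`, `bsdp_or_classX1`). Consequently
the good-Eisenstein locus is ONE class-level kernel statement:

* `forall_bsdp_goodEisenstein_iff_bsdpOnClassX1` — granted the PUBLISHED named facts
  (Castella–Grossi–Skinner 2025 Thm. D, Greenberg–Vatsal 2000 Thm. 1.3, Greenberg 1999 Thm. 4.1,
  modularity, Gross–Zagier–Kolyvagin): (`BSD(E,p)` for EVERY globally minimal elliptic `W/ℚ` and
  every good prime `p > 2` with `E[p]` reducible and `ord_{s=1} L(E,s) ≤ 1`) **⟺** the typed class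
  statement `BSDpOnClassX1`. X1 is not merely "contained in" the residue: it IS the residue.
* `bsdp_goodEisenstein_of_KY_of_mazurMC_rankZero` — the same locus ⇐ Keller–Yin's rank-one display
  (OPEN, announced) + Mazur's (MC) at the class-X1 pairs of analytic rank `0` + published facts.
* `forall_bsdp_goodEisenstein_iff_mazurMC_rankZero_of_KY` — granted Keller–Yin's display and the
  published facts (now also Wuthrich 2014 Thm. 16, prover B's converse): (`BSD(E,p)` on the whole
  good-Eisenstein locus `p > 2`, `r_an ≤ 1`) **⟺** (Mazur's cyclotomic main conjecture at every
  class-X1 pair of analytic rank `0`) — the residue NAMED, with no per-pair input: an unstated-in-print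
  main conjecture at anomalous Eisenstein primes of parity type A (type B being Greenberg–Vatsal).

* `classX1_and_not_gvPar_of_dvd_torsionOrder`, `bsdp_of_dvd_torsionOrder_of_analyticRank_eq_one_of_KY`,
  `mazurMainConjecture_iff_bsdp_of_dvd_torsionOrder_of_analyticRank_eq_zero` — the TORSION
  sub-population needs no class hypothesis at all: `p ∣ #E(ℚ)_tors` at a good `p > 2` forces class
  X1 of type A (gen 6 anomaly lemma + gen 3 parity lemma); at `r_an = 1` `BSD(E,p)` then rests on
  Keller–Yin's display alone, at `r_an = 0` it is EQUIVALENT to Mazur's main conjecture at `(E, p)`.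

References: [CastellaGrossiSkinner2025] Thm. D; [GreenbergVatsal2000] Thm. (1.3); [GreenbergLNM1716]
Thm. 4.1; [KellerYin2024] Thm. 4.2.1 (= Thm. C of v2's introduction) and §0.5; [Wuthrich2014]
Thm. 16; [Miller2011LMS] Def. 1.1; RESIDUAL-CASES.md §a.1 C6/C7, §a.2 X1; cell files CLASSES.md /
AXIOMS.md (x1a gen 6 rows); `b2b-bsdres-x1a/X1-CHAIN.md` §13.
-/

noncomputable section

open scoped Classical

open WeierstrassCurve Literature.NumberTheory.EllipticCurves
  Literature.NumberTheory.EllipticCurves.ModularForms Literature.NumberTheory.EllipticCurves.Rank1Residual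
  Summit.BirchSwinnertonDyer.BirchSwinnertonDyer.Theorems.Rank1ResidualX1Defs
  Summit.BirchSwinnertonDyer.BirchSwinnertonDyer.Theorems.Rank1ResidualX1Converse

set_option linter.dupNamespace false
set_option autoImplicit false

namespace Summit.BirchSwinnertonDyer.BirchSwinnertonDyer.Theorems.Rank1ResidualX1GoodEisenstein

/-- **The good-Eisenstein locus from the class statement X1.** Granted `BSDpOnClassX1` (the typed
TARGET of class X1) and the PUBLISHED named facts (CGS 2025 Thm. D `hD`, Greenberg–Vatsal 2000
Thm. 1.3 `hGV`, Greenberg 1999 Thm. 4.1 `hGr`, modularity `hmod`/`hmodP`, Gross–Zagier–Kolyvagin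
`hGZK`): every globally minimal elliptic `W/ℚ` and every good prime `p > 2` with `E[p]` reducible and
`ord_{s=1} L(E,s) ≤ 1` satisfies Miller's `BSD(E,p)` — by the binder-free dichotomy
`Rank1Residual.bsdp_or_classX1`. [cite: CastellaGrossiSkinner2025, Theorem D]
[cite: GreenbergVatsal2000, Thm. (1.3)] [cite: Miller2011LMS, Def. 1.1] -/
theorem bsdp_goodEisenstein_of_bsdpOnClassX1 (hX1 : BSDpOnClassX1)
    (hD : CastellaGrossiSkinner2025.thmD_padicValRat_bsd_rank_le_one)
    (hGV : GreenbergVatsal2000.thm13_charIdeal_eq_of_gvPar) (hGr : greenberg_charValue_rankZero)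
    (hmod : hasEntireLFunction_rat) (hmodP : nonempty_modularParametrizationData)
    (hGZK : rank_eq_analyticRank_of_analyticRank_le_one)
    (W : WeierstrassCurve ℚ) [W.IsElliptic] [W.IsGloballyMinimal] (p : ℕ) [Fact p.Prime]
    (hp : 2 < p) (hgood : Good W p) (hred : Red W p) (hr : W.analyticRank ≤ 1) : BSDp W p :=
  (bsdp_or_classX1 hD hGV hGr hmod hmodP hGZK W p hp hgood hred hr).elim id fun hX ↦ hX1 W p hX hr

/-- **X1 IS the good-Eisenstein residue (kernel `Iff`, no per-pair datum).** Granted the PUBLISHED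
named facts (CGS 2025 Thm. D, Greenberg–Vatsal 2000 Thm. 1.3 + Greenberg 1999 Thm. 4.1, modularity,
Gross–Zagier–Kolyvagin): (`BSD(E,p)` for every globally minimal elliptic `W/ℚ` and every good prime
`p > 2` with `E[p]` reducible and `ord_{s=1} L(E,s) ≤ 1`) ⟺ `BSDpOnClassX1`. (`→`: a class-X1 pair
has `2 < p`, `red(p)`, `good(p)` by definition; `←`: `bsdp_goodEisenstein_of_bsdpOnClassX1`.)
RESIDUAL-CASES §a.1 C6/C7 vs §a.2 X1 as one sentence. [cite: CastellaGrossiSkinner2025, Theorem D]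
[cite: GreenbergVatsal2000, Thm. (1.3)] [cite: GreenbergLNM1716, Thm. 4.1] -/
theorem forall_bsdp_goodEisenstein_iff_bsdpOnClassX1
    (hD : CastellaGrossiSkinner2025.thmD_padicValRat_bsd_rank_le_one)
    (hGV : GreenbergVatsal2000.thm13_charIdeal_eq_of_gvPar) (hGr : greenberg_charValue_rankZero)
    (hmod : hasEntireLFunction_rat) (hmodP : nonempty_modularParametrizationData)
    (hGZK : rank_eq_analyticRank_of_analyticRank_le_one) :
    (∀ (W : WeierstrassCurve ℚ) [W.IsElliptic] [W.IsGloballyMinimal] (p : ℕ) [Fact p.Prime],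
      2 < p → Good W p → Red W p → W.analyticRank ≤ 1 → BSDp W p) ↔ BSDpOnClassX1 := by
  constructor
  · intro h W _ _ p _ hX hr
    exact h W p hX.1 hX.2.2.1 hX.2.1 hr
  · intro hX1 W _ _ p _ hp hgood hred hr
    exact bsdp_goodEisenstein_of_bsdpOnClassX1 hX1 hD hGV hGr hmod hmodP hGZK W p hp hgood hred hr

/-- **The good-Eisenstein locus from Keller–Yin's display and Mazur's (MC) at the rank-`0` class-X1
pairs.** For every globally minimal elliptic `W/ℚ` and good prime `p > 2` with `E[p]` reducible and
`ord_{s=1} L(E,s) ≤ 1`: Miller's `BSD(E,p)`, granted (i) `MazurMainConjecture` at every class-X1 pair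
of analytic rank `0` (`hA0`; UNSTATED IN PRINT at parity type A, Greenberg–Vatsal's theorem at type B),
(ii) Keller–Yin's rank-one display (`hKY`, arXiv:2402.12781v2 Thm. 4.2.1 = Thm. C, ANNOUNCED
PREPRINT, explicit OPEN hypothesis), and (iii) the PUBLISHED named facts: CGS 2025 Thm. D,
Greenberg–Vatsal 2000 Thm. 1.3, Greenberg 1999 Thm. 4.1, modularity (three spellings), Hoffstein–Luo
1997, Gross–Zagier 1986 Thm. I.7.3, Gross–Zagier–Kolyvagin. Composition of
`Rank1ResidualX1Defs.bsdpOnClassX1_of_KY_of_mazurMC_rankZero` with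
`bsdp_goodEisenstein_of_bsdpOnClassX1`. [cite: KellerYin2024, Thm. 4.2.1 (p. 22) and §0.5]
[cite: CastellaGrossiSkinner2025, Theorem D] [cite: GreenbergVatsal2000, Thm. (1.3)] -/
theorem bsdp_goodEisenstein_of_KY_of_mazurMC_rankZero
    (hA0 : ∀ (W : WeierstrassCurve ℚ) [W.IsElliptic] [W.IsGloballyMinimal] (p : ℕ) [Fact p.Prime],
      ClassX1 W p → W.analyticRank = 0 → MazurMainConjecture W p)
    (hKY : KellerYin2024.thm421_rankOne_display_OPEN)
    (hD : CastellaGrossiSkinner2025.thmD_padicValRat_bsd_rank_le_one)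
    (hGV : GreenbergVatsal2000.thm13_charIdeal_eq_of_gvPar) (hGr : greenberg_charValue_rankZero)
    (hmod : hasEntireLFunction_rat) (hmodP : nonempty_modularParametrizationData)
    (hmod' : exists_isNewformOf) (hHL : HoffsteinLuo1997_exists_twist_L_one_ne_zero)
    (hGZ : GrossZagier1986_thm_I_7_3) (hGZK : rank_eq_analyticRank_of_analyticRank_le_one)
    (W : WeierstrassCurve ℚ) [W.IsElliptic] [W.IsGloballyMinimal] (p : ℕ) [Fact p.Prime]
    (hp : 2 < p) (hgood : Good W p) (hred : Red W p) (hr : W.analyticRank ≤ 1) : BSDp W p :=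
  bsdp_goodEisenstein_of_bsdpOnClassX1
    (bsdpOnClassX1_of_KY_of_mazurMC_rankZero hA0 hKY hGV hGr hmodP hmod' hHL hGZ hGZK)
    hD hGV hGr hmod hmodP hGZK W p hp hgood hred hr

/-- **The residue NAMED: granted Keller–Yin's display and the published facts, `BSD(E,p)` on the whole
good-Eisenstein locus (`p > 2`, `r_an ≤ 1`) ⟺ Mazur's cyclotomic main conjecture at every class-X1
pair of analytic rank `0`.** Published named facts: CGS 2025 Thm. D (`hD`), Greenberg–Vatsal 2000
Thm. 1.3 (`hGV`), Greenberg 1999 Thm. 4.1 (`hGr`), Wuthrich 2014 Thm. 16 (`hW16`, the converse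
direction, prover B's `mazurMainConjectureOnX1_rankZero_iff`), modularity (`hmod`, `hmodP`, `hmod'`),
Hoffstein–Luo 1997 (`hHL`), Gross–Zagier 1986 I.7.3 (`hGZ`), Gross–Zagier–Kolyvagin (`hGZK`); the one
OPEN hypothesis is `hKY` (ANNOUNCED PREPRINT). Chain: locus ⟺ `BSDpOnClassX1`
(`forall_bsdp_goodEisenstein_iff_bsdpOnClassX1`) ⟺ its rank-`0` half
(`Rank1ResidualX1Defs.bsdpOnClassX1_iff_rankZero_of_KY`) ⟺ (MC) there
(`Rank1ResidualX1Converse.mazurMainConjectureOnX1_rankZero_iff`). So at good Eisenstein primes the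
cell's residual is exactly {Keller–Yin Thms. 3.0.11 + 7.0.6 (announced)} ∪ {Mazur's (MC) at rank-`0`
anomalous pairs of parity type A (unstated in print)} — with no per-pair datum left in the kernel.
[cite: KellerYin2024, Thm. 4.2.1 (p. 22) and §0.5] [cite: CastellaGrossiSkinner2025, Theorem D]
[cite: Wuthrich2014, Thm. 16 (p. 393)] [cite: GreenbergLNM1716, Thm. 4.1] -/
theorem forall_bsdp_goodEisenstein_iff_mazurMC_rankZero_of_KY
    (hKY : KellerYin2024.thm421_rankOne_display_OPEN)
    (hD : CastellaGrossiSkinner2025.thmD_padicValRat_bsd_rank_le_one)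
    (hGV : GreenbergVatsal2000.thm13_charIdeal_eq_of_gvPar) (hGr : greenberg_charValue_rankZero)
    (hW16 : Wuthrich2014.charIdeal_dvd_padicLFunction)
    (hmod : hasEntireLFunction_rat) (hmodP : nonempty_modularParametrizationData)
    (hmod' : exists_isNewformOf) (hHL : HoffsteinLuo1997_exists_twist_L_one_ne_zero)
    (hGZ : GrossZagier1986_thm_I_7_3) (hGZK : rank_eq_analyticRank_of_analyticRank_le_one) :
    (∀ (W : WeierstrassCurve ℚ) [W.IsElliptic] [W.IsGloballyMinimal] (p : ℕ) [Fact p.Prime],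
      2 < p → Good W p → Red W p → W.analyticRank ≤ 1 → BSDp W p) ↔
    (∀ (W : WeierstrassCurve ℚ) [W.IsElliptic] [W.IsGloballyMinimal] (p : ℕ) [Fact p.Prime],
      ClassX1 W p → W.analyticRank = 0 → MazurMainConjecture W p) := by
  rw [forall_bsdp_goodEisenstein_iff_bsdpOnClassX1 hD hGV hGr hmod hmodP hGZK,
    bsdpOnClassX1_iff_rankZero_of_KY hKY hGV hGr hmodP hmod' hHL hGZ hGZK,
    mazurMainConjectureOnX1_rankZero_iff hW16 hGr hmodP hGZK]

/-! ### The torsion sub-population: `p ∣ #E(ℚ)_tors` at a good `p > 2` puts `(E, p)` in class X1 of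
type A with no further hypothesis -/

/-- **Rational `p`-torsion at a good `p > 2` ⇒ class X1, parity type A.** For `W/ℚ` globally minimal
elliptic, `2 < p` good and `p ∣ #E(ℚ)_tors`: `ClassX1 W p ∧ ¬ GVPar W p` — reducible (the line of the
torsion point), anomalous (`Rank1Residual.anom_of_dvd_torsionOrder`, gen 6: `E(ℚ)_tors ↪ Ẽ(𝔽_p)`),
and of type A (`Rank1Residual.not_gvPar_of_anom_of_nsmul_eq_zero`, gen 3: the torsion line is
unramified and even), so the class clause `¬(r_an = 0 ∧ gvpar)` holds in every rank. E.g. `11a1@5`,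
`14a1@3`, `26b1@7`. [cite: SilvermanAEC2009, VII.3.1(b) and VII.3.4] [cite: GreenbergVatsal2000, Thm. (1.3)] -/
theorem classX1_and_not_gvPar_of_dvd_torsionOrder (W : WeierstrassCurve ℚ) [W.IsElliptic]
    [W.IsGloballyMinimal] (p : ℕ) [Fact p.Prime] (hp : 2 < p) (hgood : Good W p)
    (htor : p ∣ W.torsionOrder) : ClassX1 W p ∧ ¬ GVPar W p := by
  have hA : Anom W p := anom_of_dvd_torsionOrder W p hp hgood htor
  obtain ⟨T, hT⟩ := exists_addOrderOf_eq_of_dvd_torsionOrder W p htor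
  have hT0 : T ≠ 0 := by
    rintro rfl
    rw [addOrderOf_zero] at hT
    omega
  have hpT : p • T = 0 := hT ▸ addOrderOf_nsmul_eq_zero T
  have hngv : ¬ GVPar W p :=
    Rank1Residual.not_gvPar_of_anom_of_nsmul_eq_zero W (by omega) hA T hT0 hpT
  exact ⟨⟨hp, hA.1, hgood, hA, fun h ↦ hngv h.2⟩, hngv⟩

/-- **Rank one with rational `p`-torsion at a good `p > 2`: `BSD(E,p)` modulo ONLY Keller–Yin's
display.** For `W/ℚ` globally minimal elliptic, `2 < p` good, `p ∣ #E(ℚ)_tors` and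
`ord_{s=1} L(E,s) = 1`: `BSDp W p`, from `KellerYin2024.thm421_rankOne_display_OPEN` (ANNOUNCED
PREPRINT, explicit hypothesis) and the PUBLISHED Greenberg–Vatsal 2000 Thm. 1.3, Greenberg 1999
Thm. 4.1, modularity, Hoffstein–Luo 1997, Gross–Zagier 1986 I.7.3, Gross–Zagier–Kolyvagin — no
class/parity/anomaly hypothesis left, all being consequences of the torsion point
(`classX1_and_not_gvPar_of_dvd_torsionOrder`; then `bsdp_of_classX1_typeA_of_analyticRank_eq_one`).
[cite: KellerYin2024, Thm. 4.2.1 and its proof (p. 22)] -/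
theorem bsdp_of_dvd_torsionOrder_of_analyticRank_eq_one_of_KY
    (hKY : KellerYin2024.thm421_rankOne_display_OPEN)
    (hGV : GreenbergVatsal2000.thm13_charIdeal_eq_of_gvPar) (hGr : greenberg_charValue_rankZero)
    (hmod : nonempty_modularParametrizationData) (hmod' : exists_isNewformOf)
    (hHL : HoffsteinLuo1997_exists_twist_L_one_ne_zero) (hGZ : GrossZagier1986_thm_I_7_3)
    (hGZK : rank_eq_analyticRank_of_analyticRank_le_one)
    (W : WeierstrassCurve ℚ) [W.IsElliptic] [W.IsGloballyMinimal] (p : ℕ) [Fact p.Prime]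
    (hp : 2 < p) (hgood : Good W p) (htor : p ∣ W.torsionOrder) (hr : W.analyticRank = 1) :
    BSDp W p :=
  have hX := classX1_and_not_gvPar_of_dvd_torsionOrder W p hp hgood htor
  bsdp_of_classX1_typeA_of_analyticRank_eq_one hKY hGV hGr hmod hmod' hHL hGZ hGZK W p hX.1 hX.2 hr

/-- **Rank zero with rational `p`-torsion at a good `p > 2`: Mazur's main conjecture at `(E, p)` ⟺
`BSD(E,p)`** (granted the PUBLISHED Wuthrich 2014 Thm. 16, Greenberg 1999 Thm. 4.1, modularity,
Gross–Zagier–Kolyvagin): the pair is class X1 of type A (`classX1_and_not_gvPar_of_dvd_torsionOrder`),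
where prover B's `Rank1ResidualX1Converse.mazurMainConjecture_iff_bsdp` applies. So each per-curve
`BSD(E,p)` certificate of the census at such a pair (e.g. `11a1@5`, the Greenberg–Vatsal 2000 p. 5
example) IS Mazur's main conjecture there. [cite: Wuthrich2014, Thm. 16 (p. 393)]
[cite: GreenbergLNM1716, Thm. 4.1 and §5 (closing examples)] -/
theorem mazurMainConjecture_iff_bsdp_of_dvd_torsionOrder_of_analyticRank_eq_zero
    (hW16 : Wuthrich2014.charIdeal_dvd_padicLFunction) (hGr : greenberg_charValue_rankZero)
    (hmod : nonempty_modularParametrizationData) (hGZK : rank_eq_analyticRank_of_analyticRank_le_one)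
    (W : WeierstrassCurve ℚ) [W.IsElliptic] [W.IsGloballyMinimal] (p : ℕ) [Fact p.Prime]
    (hp : 2 < p) (hgood : Good W p) (htor : p ∣ W.torsionOrder) (hr0 : W.analyticRank = 0) :
    MazurMainConjecture W p ↔ BSDp W p :=
  mazurMainConjecture_iff_bsdp hW16 hGr hmod hGZK W p
    (classX1_and_not_gvPar_of_dvd_torsionOrder W p hp hgood htor).1 hr0

/-! ### (gen 6, append) Keller–Yin's Theorem C AS STATED ⟺ the typed class statement X1, on the
published record -/

/-- **Keller–Yin's announced Theorem C (= Thm. 4.2.1, verbatim `p`-part shape, WHOLE good-Eisenstein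
locus) is equivalent, granted the PUBLISHED named facts, to the cell's typed target `BSDpOnClassX1`.**
`KellerYin2024.thm421_pPart_OPEN` says: for every globally minimal elliptic `W/ℚ` and prime `p ≠ 2`
of good reduction with `E[p]` reducible and `ord_{s=1} L(E,s) ≤ 1`, the print shape `PPart W p`.
(`→`) restrict to class X1 and pass to Miller's `BSD(E,p)` (`Rank1Residual.bsdp_of_pPart`,
modularity + Gross–Zagier–Kolyvagin). (`←`) outside X1 the locus is COVERED by Castella–Grossi–Skinner
2025 Thm. D ∪ Greenberg–Vatsal 2000 Thm. 1.3 + Greenberg 1999 Thm. 4.1 with no per-pair datum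
(`bsdp_goodEisenstein_of_bsdpOnClassX1`, gen 6), and `BSD(E,p) ⇒ PPart` (`Rank1Residual.pPart_of_bsdp`).
READING: the NEW content of the announced theorem beyond the published record is EXACTLY class X1 —
the kernel form of RESIDUAL-CASES §a.2 "X1 = Keller–Yin's theorem minus CGS/GV". Neither side is a
theorem of the tree (left: ANNOUNCED PREPRINT, `_OPEN`; right: `@[conjecture]` typed target).
[cite: KellerYin2024, Thm. 4.2.1 (p. 22) = Thm. C] [cite: CastellaGrossiSkinner2025, Theorem D]
[cite: GreenbergVatsal2000, Thm. (1.3)] [cite: GreenbergLNM1716, Thm. 4.1] -/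
theorem thm421_pPart_OPEN_iff_bsdpOnClassX1
    (hD : CastellaGrossiSkinner2025.thmD_padicValRat_bsd_rank_le_one)
    (hGV : GreenbergVatsal2000.thm13_charIdeal_eq_of_gvPar) (hGr : greenberg_charValue_rankZero)
    (hmod : hasEntireLFunction_rat) (hmodP : nonempty_modularParametrizationData)
    (hGZK : rank_eq_analyticRank_of_analyticRank_le_one) :
    KellerYin2024.thm421_pPart_OPEN ↔ BSDpOnClassX1 := by
  constructor
  · intro hKY W _ _ p _ hX hr
    exact bsdp_of_pPart W p hmod hGZK hr (hKY W p hX.1.ne' hX.2.2.1 hX.2.1 hr)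
  · intro hX1 W _ _ p _ hp2 hgood hred hr
    have hp : 2 < p := lt_of_le_of_ne (Fact.out : p.Prime).two_le (Ne.symm hp2)
    exact pPart_of_bsdp hmod hGZK W p hr
      (bsdp_goodEisenstein_of_bsdpOnClassX1 hX1 hD hGV hGr hmod hmodP hGZK W p hp hgood hred hr)

/-- **Corollary: granted Keller–Yin's rank-one DISPLAY and the published facts, Keller–Yin's Theorem C
as stated ⟺ Mazur's main conjecture at the rank-`0` class-X1 pairs.** (`thm421_pPart_OPEN_iff_bsdpOnClassX1`
∘ `Rank1ResidualX1Defs.bsdpOnClassX1_iff_rankZero_of_KY` ∘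
`Rank1ResidualX1Converse.mazurMainConjectureOnX1_rankZero_iff`.) Both Keller–Yin `Prop`s are OPEN
hypotheses (ANNOUNCED PREPRINT); this records that, on the published record, the `p`-part theorem they
announce carries exactly the cyclotomic main conjecture at anomalous Eisenstein pairs of type A and
analytic rank `0` beyond their own rank-one display — the statement §0.5 of the preprint asserts in
prose. [cite: KellerYin2024, Thm. 4.2.1 (p. 22) and §0.5] [cite: Wuthrich2014, Thm. 16 (p. 393)] -/
theorem thm421_pPart_OPEN_iff_mazurMC_rankZero_of_KY
    (hKY : KellerYin2024.thm421_rankOne_display_OPEN)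
    (hD : CastellaGrossiSkinner2025.thmD_padicValRat_bsd_rank_le_one)
    (hGV : GreenbergVatsal2000.thm13_charIdeal_eq_of_gvPar) (hGr : greenberg_charValue_rankZero)
    (hW16 : Wuthrich2014.charIdeal_dvd_padicLFunction)
    (hmod : hasEntireLFunction_rat) (hmodP : nonempty_modularParametrizationData)
    (hmod' : exists_isNewformOf) (hHL : HoffsteinLuo1997_exists_twist_L_one_ne_zero)
    (hGZ : GrossZagier1986_thm_I_7_3) (hGZK : rank_eq_analyticRank_of_analyticRank_le_one) :
    KellerYin2024.thm421_pPart_OPEN ↔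
    (∀ (W : WeierstrassCurve ℚ) [W.IsElliptic] [W.IsGloballyMinimal] (p : ℕ) [Fact p.Prime],
      ClassX1 W p → W.analyticRank = 0 → MazurMainConjecture W p) := by
  rw [thm421_pPart_OPEN_iff_bsdpOnClassX1 hD hGV hGr hmod hmodP hGZK,
    bsdpOnClassX1_iff_rankZero_of_KY hKY hGV hGr hmodP hmod' hHL hGZ hGZK,
    mazurMainConjectureOnX1_rankZero_iff hW16 hGr hmodP hGZK]

/-! ### (gen 6, append 2) Rational `p`-torsion ANYWHERE in the isogeny class: class X1 of type A,
with no hypothesis on the class mate -/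

/-- **A rational point of order `p` on ANY `ℚ`-isogenous curve, at a good `p > 2`, puts `(E, p)` in
class X1 of parity type A** — hypothesis-minimal form of gen 3's
`Rank1ResidualX1Defs.not_gvPar_of_isIsogenous_of_torsion` (which assumed `ClassX1 W p` and
`Anom W' p`): for globally minimal elliptic `W ∼ W'` over `ℚ`, `2 < p`, `good(p)` for `W` and
`p ∣ #E'(ℚ)_tors`: `ClassX1 W p ∧ ¬ GVPar W p`. The class mate is X1 of type A by
`classX1_and_not_gvPar_of_dvd_torsionOrder` (gen 6: torsion ⇒ anomalous; gen 3: torsion line even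
and unramified), and both `ClassX1` (x1b `Rank1Residual.classX1_iff_of_isIsogenous`: reducibility,
good reduction, `a_p` (Faltings) and the parity type are isogeny invariants) and the Greenberg–Vatsal
type (`gvPar_iff_of_isIsogenous`) transport along the isogeny. Census reading (X1-CENSUS-g2 §2e):
1438 of the 1487 type-A classes `N < 2·10⁴` contain a curve with rational `p`-torsion — for them
membership in X1a needs no `a_p` or kernel-character computation at all.
[cite: SilvermanAEC2009, VII.3.1(b), VII.3.4 and Cor. VII.7.2] [cite: GreenbergVatsal2000, Thm. (1.3)] -/
theorem classX1_and_not_gvPar_of_isIsogenous_of_dvd_torsionOrder (W W' : WeierstrassCurve ℚ)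
    [W.IsElliptic] [W.IsGloballyMinimal] [W'.IsElliptic] [W'.IsGloballyMinimal] (p : ℕ)
    [Fact p.Prime] (hp : 2 < p) (hgood : Good W p) (h : IsIsogenous W W')
    (htor : p ∣ W'.torsionOrder) : ClassX1 W p ∧ ¬ GVPar W p := by
  have hgood' : Good W' p := (h.hasGoodReductionAtPrime_iff p).mp hgood
  obtain ⟨hX', hngv'⟩ := classX1_and_not_gvPar_of_dvd_torsionOrder W' p hp hgood' htor
  have hX : ClassX1 W p := (Rank1Residual.classX1_iff_of_isIsogenous h).mpr hX'
  exact ⟨hX, fun hgv ↦ hngv'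
    ((gvPar_iff_of_isIsogenous W W' p (by omega) hX.2.2.2.1 hX'.2.2.2.1 h).mp hgv)⟩

/-- **Rank one, rational `p`-torsion somewhere in the class, good `p > 2` ⇒ `BSD(E,p)` modulo ONLY
Keller–Yin's display** (hypothesis-minimal form of gen 3's
`Rank1ResidualX1Defs.bsdp_of_classX1_of_analyticRank_eq_one_of_torsion`). Inputs: the ANNOUNCED
`KellerYin2024.thm421_rankOne_display_OPEN` and the PUBLISHED GV 2000 Thm. 1.3, Greenberg 1999
Thm. 4.1, modularity, Hoffstein–Luo 1997, Gross–Zagier 1986 I.7.3, Gross–Zagier–Kolyvagin.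
[cite: KellerYin2024, Thm. 4.2.1 and its proof (p. 22)] -/
theorem bsdp_of_isIsogenous_of_dvd_torsionOrder_of_analyticRank_eq_one_of_KY
    (hKY : KellerYin2024.thm421_rankOne_display_OPEN)
    (hGV : GreenbergVatsal2000.thm13_charIdeal_eq_of_gvPar) (hGr : greenberg_charValue_rankZero)
    (hmod : nonempty_modularParametrizationData) (hmod' : exists_isNewformOf)
    (hHL : HoffsteinLuo1997_exists_twist_L_one_ne_zero) (hGZ : GrossZagier1986_thm_I_7_3)
    (hGZK : rank_eq_analyticRank_of_analyticRank_le_one)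
    (W W' : WeierstrassCurve ℚ) [W.IsElliptic] [W.IsGloballyMinimal] [W'.IsElliptic]
    [W'.IsGloballyMinimal] (p : ℕ) [Fact p.Prime] (hp : 2 < p) (hgood : Good W p)
    (h : IsIsogenous W W') (htor : p ∣ W'.torsionOrder) (hr : W.analyticRank = 1) : BSDp W p :=
  have hX := classX1_and_not_gvPar_of_isIsogenous_of_dvd_torsionOrder W W' p hp hgood h htor
  bsdp_of_classX1_typeA_of_analyticRank_eq_one hKY hGV hGr hmod hmod' hHL hGZ hGZK W p hX.1 hX.2 hr

end Summit.BirchSwinnertonDyer.BirchSwinnertonDyer.Theorems.Rank1ResidualX1GoodEisenstein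

end
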